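import Summits.MatrixMultiplication.MatrixMultiplication.Theorems.SoloBlindKraftSets

/-!
# The triangle quotient is admissible, I: zero-sum freeness (solo-blind s80)

Setting (K3.23.15–16 of the solo-blind Kraft programme): `h` is zero-sum free on `S` in a group of
exponent 3, `τ` is H-good (`∑ T ≠ τ + τ` for all `T ⊆ S`), and `S` carries a TRIANGLE of 3-term
representations of `τ`: six distinct elements `a b c q1 q2 q3 ∈ S` with `h a + h q1 + h q3 = τ`,
`h b + h q1 + h q2 = τ`, `h c + h q2 + h q3 = τ` (the triples `{a,q1,q3}`, `{b,q1,q2}`, `{c,q2,q3}`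
pairwise meeting in `q1, q2, q3`).  Let `K'` be the subgroup `{n1 • h q1 + n2 • h q2 + n3 • h q3}`
(at most 27 elements).  This file proves, by a table of 27 explicit certificates (a part `Y` of the
triangle making `U ∪ Y` a zero sum or a `(τ+τ)`-sum), that a nonempty `U ⊆ S` avoiding the triangle
never sums into `K'` (`soloBlind_triangle_sum_ne_combo`), and the corollary
`soloBlind_triangle_quot_zsf`: modulo any additive hom whose kernel lies in `K'` the outside set
`S \ hexad` stays zero-sum free.  Part II (`SoloBlindTriangleQuotHgood`) proves that `[τ]` stays
H-good; with the member classification this is the TRIANGLE MOVE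
`E(τ;S) ≤ 3/8 + E_{G/K'}([τ]; S ∖ hexad)/4 ≤ 1/2`, the case `N_3 = 3` of Conjecture E on
zero-sum-free sets (pen, K3.23.16).
-/

namespace Summit.MatrixMultiplication.MatrixMultiplication.Theorems

open Finset

universe u

variable {ι : Type*} [DecidableEq ι]
variable {G : Type u} [AddCommGroup G]
variable {G' : Type u} [AddCommGroup G']

/-- Torsion closer: in exponent 3, `A = B` as soon as `A - B` is a combination of tripled
elements. -/
theorem soloBlind_tri_close (three : ∀ g : G, g + g + g = 0) (t x y z : G) (m0 m1 m2 m3 : ℤ)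
    {A B : G}
    (e : A - B = m0 • (t + t + t) + m1 • (x + x + x) + m2 • (y + y + y) + m3 • (z + z + z)) :
    A = B := by
  rw [three, three, three, three, smul_zero, smul_zero, smul_zero, smul_zero, add_zero, add_zero,
    add_zero] at e
  exact sub_eq_zero.mp e

set_option maxHeartbeats 800000 in
/-- TRIANGLE QUOTIENT, zero-sum freeness: a nonempty subset of `S` avoiding the triangle never
sums into `K' = {n1 • h q1 + n2 • h q2 + n3 • h q3}` (27 explicit certificates). -/
theorem soloBlind_triangle_sum_ne_combo (three : ∀ g : G, g + g + g = 0) {h : ι → G} {S : Finset ι}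
    (zsf : ∀ T ⊆ S, T.Nonempty → ∑ i ∈ T, h i ≠ 0) {τ : G} (hgood : ∀ T ⊆ S, ∑ i ∈ T, h i ≠ τ + τ)
    {a b c q1 q2 q3 : ι} (ha : a ∈ S) (hb : b ∈ S) (hc : c ∈ S) (hq1 : q1 ∈ S) (hq2 : q2 ∈ S)
    (hq3 : q3 ∈ S) (d_a_b : a ≠ b) (d_a_c : a ≠ c) (d_a_q1 : a ≠ q1) (d_a_q2 : a ≠ q2)
    (d_a_q3 : a ≠ q3) (d_b_c : b ≠ c) (d_b_q1 : b ≠ q1) (d_b_q2 : b ≠ q2) (d_b_q3 : b ≠ q3)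
    (d_c_q1 : c ≠ q1) (d_c_q2 : c ≠ q2) (d_c_q3 : c ≠ q3) (d_q1_q2 : q1 ≠ q2) (d_q1_q3 : q1 ≠ q3)
    (d_q2_q3 : q2 ≠ q3)
    (hA : h a + h q1 + h q3 = τ) (hB : h b + h q1 + h q2 = τ) (hC : h c + h q2 + h q3 = τ)
    {U : Finset ι} (hUS : U ⊆ S) (haU : a ∉ U) (hbU : b ∉ U) (hcU : c ∉ U) (hq1U : q1 ∉ U)
    (hq2U : q2 ∉ U) (hq3U : q3 ∉ U) (hne : U.Nonempty)
    (n1 n2 n3 : ℕ) (hn1 : n1 < 3) (hn2 : n2 < 3) (hn3 : n3 < 3) :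
    ∑ i ∈ U, h i ≠ n1 • h q1 + n2 • h q2 + n3 • h q3 := by
  have ha' : h a = τ - h q1 - h q3 := by rw [← hA]; abel
  have hb' : h b = τ - h q1 - h q2 := by rw [← hB]; abel
  have hc' : h c = τ - h q2 - h q3 := by rw [← hC]; abel
  have hins : ∀ y : ι, y ∈ S → ∀ V : Finset ι, V ⊆ S → insert y V ⊆ S :=
    fun y hy V hV => Finset.insert_subset_iff.mpr ⟨hy, hV⟩
  intro hU
  interval_cases n1 <;> interval_cases n2 <;> interval_cases n3
  · -- k = (0, 0, 0): zero sum on U ∪ {}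
    exact zsf (U)
      hUS hne
      (by rw [hU]
          exact soloBlind_tri_close three τ (h q1) (h q2) (h q3) (0) (0) (0) (0) (by
            (try simp only [zero_smul, add_zero]); abel))
  · -- k = (0, 0, 1): (τ+τ)-sum on U ∪ {a, c, q1, q2, q3}
    have N1 : a ∉ insert c (insert q1 (insert q2 (insert q3 U))) := by
      simp only [Finset.mem_insert, not_or]; exact ⟨d_a_c, d_a_q1, d_a_q2, d_a_q3, haU⟩
    have N2 : c ∉ insert q1 (insert q2 (insert q3 U)) := by
      simp only [Finset.mem_insert, not_or]; exact ⟨d_c_q1, d_c_q2, d_c_q3, hcU⟩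
    have N3 : q1 ∉ insert q2 (insert q3 U) := by
      simp only [Finset.mem_insert, not_or]; exact ⟨d_q1_q2, d_q1_q3, hq1U⟩
    have N4 : q2 ∉ insert q3 U := by
      simp only [Finset.mem_insert, not_or]; exact ⟨d_q2_q3, hq2U⟩
    exact hgood (insert a (insert c (insert q1 (insert q2 (insert q3 U)))))
      (hins _ ha _ (hins _ hc _ (hins _ hq1 _ (hins _ hq2 _ (hins _ hq3 _ hUS)))))
      (by rw [Finset.sum_insert N1, Finset.sum_insert N2, Finset.sum_insert N3,
            Finset.sum_insert N4, Finset.sum_insert hq3U, hU]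
          simp only [ha', hc']
          exact soloBlind_tri_close three τ (h q1) (h q2) (h q3) (0) (0) (0) (0) (by
            (try simp only [zero_smul, one_smul, add_zero, zero_add]); abel))
  · -- k = (0, 0, 2): zero sum on U ∪ {q3}
    exact zsf (insert q3 U)
      (hins _ hq3 _ hUS) (Finset.insert_nonempty _ _)
      (by rw [Finset.sum_insert hq3U, hU]
          exact soloBlind_tri_close three τ (h q1) (h q2) (h q3) (0) (0) (0) (1) (by
            (try simp only [zero_smul, one_smul, add_zero, zero_add]); abel))
  · -- k = (0, 1, 0): (τ+τ)-sum on U ∪ {b, c, q1, q2, q3}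
    have N1 : b ∉ insert c (insert q1 (insert q2 (insert q3 U))) := by
      simp only [Finset.mem_insert, not_or]; exact ⟨d_b_c, d_b_q1, d_b_q2, d_b_q3, hbU⟩
    have N2 : c ∉ insert q1 (insert q2 (insert q3 U)) := by
      simp only [Finset.mem_insert, not_or]; exact ⟨d_c_q1, d_c_q2, d_c_q3, hcU⟩
    have N3 : q1 ∉ insert q2 (insert q3 U) := by
      simp only [Finset.mem_insert, not_or]; exact ⟨d_q1_q2, d_q1_q3, hq1U⟩
    have N4 : q2 ∉ insert q3 U := by
      simp only [Finset.mem_insert, not_or]; exact ⟨d_q2_q3, hq2U⟩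
    exact hgood (insert b (insert c (insert q1 (insert q2 (insert q3 U)))))
      (hins _ hb _ (hins _ hc _ (hins _ hq1 _ (hins _ hq2 _ (hins _ hq3 _ hUS)))))
      (by rw [Finset.sum_insert N1, Finset.sum_insert N2, Finset.sum_insert N3,
            Finset.sum_insert N4, Finset.sum_insert hq3U, hU]
          simp only [hb', hc']
          exact soloBlind_tri_close three τ (h q1) (h q2) (h q3) (0) (0) (0) (0) (by
            (try simp only [zero_smul, one_smul, add_zero, zero_add]); abel))
  · -- k = (0, 1, 1): (τ+τ)-sum on U ∪ {a, c, q1, q3}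
    have N1 : a ∉ insert c (insert q1 (insert q3 U)) := by
      simp only [Finset.mem_insert, not_or]; exact ⟨d_a_c, d_a_q1, d_a_q3, haU⟩
    have N2 : c ∉ insert q1 (insert q3 U) := by
      simp only [Finset.mem_insert, not_or]; exact ⟨d_c_q1, d_c_q3, hcU⟩
    have N3 : q1 ∉ insert q3 U := by
      simp only [Finset.mem_insert, not_or]; exact ⟨d_q1_q3, hq1U⟩
    exact hgood (insert a (insert c (insert q1 (insert q3 U))))
      (hins _ ha _ (hins _ hc _ (hins _ hq1 _ (hins _ hq3 _ hUS))))
      (by rw [Finset.sum_insert N1, Finset.sum_insert N2,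
            Finset.sum_insert N3, Finset.sum_insert hq3U, hU]
          simp only [ha', hc']
          exact soloBlind_tri_close three τ (h q1) (h q2) (h q3) (0) (0) (0) (0) (by
            (try simp only [zero_smul, one_smul, add_zero, zero_add]); abel))
  · -- k = (0, 1, 2): (τ+τ)-sum on U ∪ {a, c, q1}
    have N1 : a ∉ insert c (insert q1 U) := by
      simp only [Finset.mem_insert, not_or]; exact ⟨d_a_c, d_a_q1, haU⟩
    have N2 : c ∉ insert q1 U := by
      simp only [Finset.mem_insert, not_or]; exact ⟨d_c_q1, hcU⟩
    exact hgood (insert a (insert c (insert q1 U)))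
      (hins _ ha _ (hins _ hc _ (hins _ hq1 _ hUS)))
      (by rw [Finset.sum_insert N1, Finset.sum_insert N2, Finset.sum_insert hq1U, hU]
          simp only [ha', hc']
          exact soloBlind_tri_close three τ (h q1) (h q2) (h q3) (0) (0) (0) (0) (by
            (try simp only [zero_smul, one_smul, add_zero, zero_add]); abel))
  · -- k = (0, 2, 0): zero sum on U ∪ {q2}
    exact zsf (insert q2 U)
      (hins _ hq2 _ hUS) (Finset.insert_nonempty _ _)
      (by rw [Finset.sum_insert hq2U, hU]
          exact soloBlind_tri_close three τ (h q1) (h q2) (h q3) (0) (0) (1) (0) (by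
            (try simp only [zero_smul, one_smul, add_zero, zero_add]); abel))
  · -- k = (0, 2, 1): (τ+τ)-sum on U ∪ {b, c, q1}
    have N1 : b ∉ insert c (insert q1 U) := by
      simp only [Finset.mem_insert, not_or]; exact ⟨d_b_c, d_b_q1, hbU⟩
    have N2 : c ∉ insert q1 U := by
      simp only [Finset.mem_insert, not_or]; exact ⟨d_c_q1, hcU⟩
    exact hgood (insert b (insert c (insert q1 U)))
      (hins _ hb _ (hins _ hc _ (hins _ hq1 _ hUS)))
      (by rw [Finset.sum_insert N1, Finset.sum_insert N2, Finset.sum_insert hq1U, hU]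
          simp only [hb', hc']
          exact soloBlind_tri_close three τ (h q1) (h q2) (h q3) (0) (0) (0) (0) (by
            (try simp only [zero_smul, one_smul, add_zero, zero_add]); abel))
  · -- k = (0, 2, 2): zero sum on U ∪ {q2, q3}
    have N1 : q2 ∉ insert q3 U := by
      simp only [Finset.mem_insert, not_or]; exact ⟨d_q2_q3, hq2U⟩
    exact zsf (insert q2 (insert q3 U))
      (hins _ hq2 _ (hins _ hq3 _ hUS)) (Finset.insert_nonempty _ _)
      (by rw [Finset.sum_insert N1, Finset.sum_insert hq3U, hU]
          exact soloBlind_tri_close three τ (h q1) (h q2) (h q3) (0) (0) (1) (1) (by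
            (try simp only [zero_smul, one_smul, add_zero, zero_add]); abel))
  · -- k = (1, 0, 0): (τ+τ)-sum on U ∪ {a, b, q1, q2, q3}
    have N1 : a ∉ insert b (insert q1 (insert q2 (insert q3 U))) := by
      simp only [Finset.mem_insert, not_or]; exact ⟨d_a_b, d_a_q1, d_a_q2, d_a_q3, haU⟩
    have N2 : b ∉ insert q1 (insert q2 (insert q3 U)) := by
      simp only [Finset.mem_insert, not_or]; exact ⟨d_b_q1, d_b_q2, d_b_q3, hbU⟩
    have N3 : q1 ∉ insert q2 (insert q3 U) := by
      simp only [Finset.mem_insert, not_or]; exact ⟨d_q1_q2, d_q1_q3, hq1U⟩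
    have N4 : q2 ∉ insert q3 U := by
      simp only [Finset.mem_insert, not_or]; exact ⟨d_q2_q3, hq2U⟩
    exact hgood (insert a (insert b (insert q1 (insert q2 (insert q3 U)))))
      (hins _ ha _ (hins _ hb _ (hins _ hq1 _ (hins _ hq2 _ (hins _ hq3 _ hUS)))))
      (by rw [Finset.sum_insert N1, Finset.sum_insert N2, Finset.sum_insert N3,
            Finset.sum_insert N4, Finset.sum_insert hq3U, hU]
          simp only [ha', hb']
          exact soloBlind_tri_close three τ (h q1) (h q2) (h q3) (0) (0) (0) (0) (by
            (try simp only [zero_smul, one_smul, add_zero]); abel))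
  · -- k = (1, 0, 1): (τ+τ)-sum on U ∪ {a, b, q1, q2}
    have N1 : a ∉ insert b (insert q1 (insert q2 U)) := by
      simp only [Finset.mem_insert, not_or]; exact ⟨d_a_b, d_a_q1, d_a_q2, haU⟩
    have N2 : b ∉ insert q1 (insert q2 U) := by
      simp only [Finset.mem_insert, not_or]; exact ⟨d_b_q1, d_b_q2, hbU⟩
    have N3 : q1 ∉ insert q2 U := by
      simp only [Finset.mem_insert, not_or]; exact ⟨d_q1_q2, hq1U⟩
    exact hgood (insert a (insert b (insert q1 (insert q2 U))))
      (hins _ ha _ (hins _ hb _ (hins _ hq1 _ (hins _ hq2 _ hUS))))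
      (by rw [Finset.sum_insert N1, Finset.sum_insert N2,
            Finset.sum_insert N3, Finset.sum_insert hq2U, hU]
          simp only [ha', hb']
          exact soloBlind_tri_close three τ (h q1) (h q2) (h q3) (0) (0) (0) (0) (by
            (try simp only [zero_smul, one_smul, add_zero]); abel))
  · -- k = (1, 0, 2): (τ+τ)-sum on U ∪ {a, c, q2}
    have N1 : a ∉ insert c (insert q2 U) := by
      simp only [Finset.mem_insert, not_or]; exact ⟨d_a_c, d_a_q2, haU⟩
    have N2 : c ∉ insert q2 U := by
      simp only [Finset.mem_insert, not_or]; exact ⟨d_c_q2, hcU⟩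
    exact hgood (insert a (insert c (insert q2 U)))
      (hins _ ha _ (hins _ hc _ (hins _ hq2 _ hUS)))
      (by rw [Finset.sum_insert N1, Finset.sum_insert N2, Finset.sum_insert hq2U, hU]
          simp only [ha', hc']
          exact soloBlind_tri_close three τ (h q1) (h q2) (h q3) (0) (0) (0) (0) (by
            (try simp only [zero_smul, one_smul, add_zero]); abel))
  · -- k = (1, 1, 0): (τ+τ)-sum on U ∪ {a, b, q1, q3}
    have N1 : a ∉ insert b (insert q1 (insert q3 U)) := by
      simp only [Finset.mem_insert, not_or]; exact ⟨d_a_b, d_a_q1, d_a_q3, haU⟩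
    have N2 : b ∉ insert q1 (insert q3 U) := by
      simp only [Finset.mem_insert, not_or]; exact ⟨d_b_q1, d_b_q3, hbU⟩
    have N3 : q1 ∉ insert q3 U := by
      simp only [Finset.mem_insert, not_or]; exact ⟨d_q1_q3, hq1U⟩
    exact hgood (insert a (insert b (insert q1 (insert q3 U))))
      (hins _ ha _ (hins _ hb _ (hins _ hq1 _ (hins _ hq3 _ hUS))))
      (by rw [Finset.sum_insert N1, Finset.sum_insert N2,
            Finset.sum_insert N3, Finset.sum_insert hq3U, hU]
          simp only [ha', hb']
          exact soloBlind_tri_close three τ (h q1) (h q2) (h q3) (0) (0) (0) (0) (by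
            (try simp only [zero_smul, one_smul, add_zero]); abel))
  · -- k = (1, 1, 1): (τ+τ)-sum on U ∪ {a, b, q1}
    have N1 : a ∉ insert b (insert q1 U) := by
      simp only [Finset.mem_insert, not_or]; exact ⟨d_a_b, d_a_q1, haU⟩
    have N2 : b ∉ insert q1 U := by
      simp only [Finset.mem_insert, not_or]; exact ⟨d_b_q1, hbU⟩
    exact hgood (insert a (insert b (insert q1 U)))
      (hins _ ha _ (hins _ hb _ (hins _ hq1 _ hUS)))
      (by rw [Finset.sum_insert N1, Finset.sum_insert N2, Finset.sum_insert hq1U, hU]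
          simp only [ha', hb']
          exact soloBlind_tri_close three τ (h q1) (h q2) (h q3) (0) (0) (0) (0) (by
            (try simp only [zero_smul, one_smul, add_zero]); abel))
  · -- k = (1, 1, 2): (τ+τ)-sum on U ∪ {a, c}
    have N1 : a ∉ insert c U := by
      simp only [Finset.mem_insert, not_or]; exact ⟨d_a_c, haU⟩
    exact hgood (insert a (insert c U))
      (hins _ ha _ (hins _ hc _ hUS))
      (by rw [Finset.sum_insert N1, Finset.sum_insert hcU, hU]
          simp only [ha', hc']
          exact soloBlind_tri_close three τ (h q1) (h q2) (h q3) (0) (0) (0) (0) (by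
            (try simp only [zero_smul, one_smul, add_zero]); abel))
  · -- k = (1, 2, 0): (τ+τ)-sum on U ∪ {b, c, q3}
    have N1 : b ∉ insert c (insert q3 U) := by
      simp only [Finset.mem_insert, not_or]; exact ⟨d_b_c, d_b_q3, hbU⟩
    have N2 : c ∉ insert q3 U := by
      simp only [Finset.mem_insert, not_or]; exact ⟨d_c_q3, hcU⟩
    exact hgood (insert b (insert c (insert q3 U)))
      (hins _ hb _ (hins _ hc _ (hins _ hq3 _ hUS)))
      (by rw [Finset.sum_insert N1, Finset.sum_insert N2, Finset.sum_insert hq3U, hU]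
          simp only [hb', hc']
          exact soloBlind_tri_close three τ (h q1) (h q2) (h q3) (0) (0) (0) (0) (by
            (try simp only [zero_smul, one_smul, add_zero]); abel))
  · -- k = (1, 2, 1): (τ+τ)-sum on U ∪ {b, c}
    have N1 : b ∉ insert c U := by
      simp only [Finset.mem_insert, not_or]; exact ⟨d_b_c, hbU⟩
    exact hgood (insert b (insert c U))
      (hins _ hb _ (hins _ hc _ hUS))
      (by rw [Finset.sum_insert N1, Finset.sum_insert hcU, hU]
          simp only [hb', hc']
          exact soloBlind_tri_close three τ (h q1) (h q2) (h q3) (0) (0) (0) (0) (by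
            (try simp only [zero_smul, one_smul, add_zero]); abel))
  · -- k = (1, 2, 2): zero sum on U ∪ {a, b, c, q1}
    have N1 : a ∉ insert b (insert c (insert q1 U)) := by
      simp only [Finset.mem_insert, not_or]; exact ⟨d_a_b, d_a_c, d_a_q1, haU⟩
    have N2 : b ∉ insert c (insert q1 U) := by
      simp only [Finset.mem_insert, not_or]; exact ⟨d_b_c, d_b_q1, hbU⟩
    have N3 : c ∉ insert q1 U := by
      simp only [Finset.mem_insert, not_or]; exact ⟨d_c_q1, hcU⟩
    exact zsf (insert a (insert b (insert c (insert q1 U))))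
      (hins _ ha _ (hins _ hb _ (hins _ hc _ (hins _ hq1 _ hUS)))) (Finset.insert_nonempty _ _)
      (by rw [Finset.sum_insert N1, Finset.sum_insert N2,
            Finset.sum_insert N3, Finset.sum_insert hq1U, hU]
          simp only [ha', hb', hc']
          exact soloBlind_tri_close three τ (h q1) (h q2) (h q3) (1) (0) (0) (0) (by
            (try simp only [zero_smul, one_smul, add_zero]); abel))
  · -- k = (2, 0, 0): zero sum on U ∪ {q1}
    exact zsf (insert q1 U)
      (hins _ hq1 _ hUS) (Finset.insert_nonempty _ _)
      (by rw [Finset.sum_insert hq1U, hU]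
          exact soloBlind_tri_close three τ (h q1) (h q2) (h q3) (0) (1) (0) (0) (by
            (try simp only [zero_smul, one_smul, add_zero, zero_add]); abel))
  · -- k = (2, 0, 1): (τ+τ)-sum on U ∪ {a, b, q2}
    have N1 : a ∉ insert b (insert q2 U) := by
      simp only [Finset.mem_insert, not_or]; exact ⟨d_a_b, d_a_q2, haU⟩
    have N2 : b ∉ insert q2 U := by
      simp only [Finset.mem_insert, not_or]; exact ⟨d_b_q2, hbU⟩
    exact hgood (insert a (insert b (insert q2 U)))
      (hins _ ha _ (hins _ hb _ (hins _ hq2 _ hUS)))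
      (by rw [Finset.sum_insert N1, Finset.sum_insert N2, Finset.sum_insert hq2U, hU]
          simp only [ha', hb']
          exact soloBlind_tri_close three τ (h q1) (h q2) (h q3) (0) (0) (0) (0) (by
            (try simp only [zero_smul, one_smul, add_zero]); abel))
  · -- k = (2, 0, 2): zero sum on U ∪ {q1, q3}
    have N1 : q1 ∉ insert q3 U := by
      simp only [Finset.mem_insert, not_or]; exact ⟨d_q1_q3, hq1U⟩
    exact zsf (insert q1 (insert q3 U))
      (hins _ hq1 _ (hins _ hq3 _ hUS)) (Finset.insert_nonempty _ _)
      (by rw [Finset.sum_insert N1, Finset.sum_insert hq3U, hU]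
          exact soloBlind_tri_close three τ (h q1) (h q2) (h q3) (0) (1) (0) (1) (by
            (try simp only [zero_smul, one_smul, add_zero, zero_add]); abel))
  · -- k = (2, 1, 0): (τ+τ)-sum on U ∪ {a, b, q3}
    have N1 : a ∉ insert b (insert q3 U) := by
      simp only [Finset.mem_insert, not_or]; exact ⟨d_a_b, d_a_q3, haU⟩
    have N2 : b ∉ insert q3 U := by
      simp only [Finset.mem_insert, not_or]; exact ⟨d_b_q3, hbU⟩
    exact hgood (insert a (insert b (insert q3 U)))
      (hins _ ha _ (hins _ hb _ (hins _ hq3 _ hUS)))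
      (by rw [Finset.sum_insert N1, Finset.sum_insert N2, Finset.sum_insert hq3U, hU]
          simp only [ha', hb']
          exact soloBlind_tri_close three τ (h q1) (h q2) (h q3) (0) (0) (0) (0) (by
            (try simp only [zero_smul, one_smul, add_zero]); abel))
  · -- k = (2, 1, 1): (τ+τ)-sum on U ∪ {a, b}
    have N1 : a ∉ insert b U := by
      simp only [Finset.mem_insert, not_or]; exact ⟨d_a_b, haU⟩
    exact hgood (insert a (insert b U))
      (hins _ ha _ (hins _ hb _ hUS))
      (by rw [Finset.sum_insert N1, Finset.sum_insert hbU, hU]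
          simp only [ha', hb']
          exact soloBlind_tri_close three τ (h q1) (h q2) (h q3) (0) (0) (0) (0) (by
            (try simp only [zero_smul, one_smul, add_zero]); abel))
  · -- k = (2, 1, 2): zero sum on U ∪ {a, b, c, q2}
    have N1 : a ∉ insert b (insert c (insert q2 U)) := by
      simp only [Finset.mem_insert, not_or]; exact ⟨d_a_b, d_a_c, d_a_q2, haU⟩
    have N2 : b ∉ insert c (insert q2 U) := by
      simp only [Finset.mem_insert, not_or]; exact ⟨d_b_c, d_b_q2, hbU⟩
    have N3 : c ∉ insert q2 U := by
      simp only [Finset.mem_insert, not_or]; exact ⟨d_c_q2, hcU⟩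
    exact zsf (insert a (insert b (insert c (insert q2 U))))
      (hins _ ha _ (hins _ hb _ (hins _ hc _ (hins _ hq2 _ hUS)))) (Finset.insert_nonempty _ _)
      (by rw [Finset.sum_insert N1, Finset.sum_insert N2,
            Finset.sum_insert N3, Finset.sum_insert hq2U, hU]
          simp only [ha', hb', hc']
          exact soloBlind_tri_close three τ (h q1) (h q2) (h q3) (1) (0) (0) (0) (by
            (try simp only [zero_smul, one_smul, add_zero]); abel))
  · -- k = (2, 2, 0): zero sum on U ∪ {q1, q2}
    have N1 : q1 ∉ insert q2 U := by
      simp only [Finset.mem_insert, not_or]; exact ⟨d_q1_q2, hq1U⟩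
    exact zsf (insert q1 (insert q2 U))
      (hins _ hq1 _ (hins _ hq2 _ hUS)) (Finset.insert_nonempty _ _)
      (by rw [Finset.sum_insert N1, Finset.sum_insert hq2U, hU]
          exact soloBlind_tri_close three τ (h q1) (h q2) (h q3) (0) (1) (1) (0) (by
            (try simp only [zero_smul, one_smul, add_zero, zero_add]); abel))
  · -- k = (2, 2, 1): zero sum on U ∪ {a, b, c, q3}
    have N1 : a ∉ insert b (insert c (insert q3 U)) := by
      simp only [Finset.mem_insert, not_or]; exact ⟨d_a_b, d_a_c, d_a_q3, haU⟩
    have N2 : b ∉ insert c (insert q3 U) := by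
      simp only [Finset.mem_insert, not_or]; exact ⟨d_b_c, d_b_q3, hbU⟩
    have N3 : c ∉ insert q3 U := by
      simp only [Finset.mem_insert, not_or]; exact ⟨d_c_q3, hcU⟩
    exact zsf (insert a (insert b (insert c (insert q3 U))))
      (hins _ ha _ (hins _ hb _ (hins _ hc _ (hins _ hq3 _ hUS)))) (Finset.insert_nonempty _ _)
      (by rw [Finset.sum_insert N1, Finset.sum_insert N2,
            Finset.sum_insert N3, Finset.sum_insert hq3U, hU]
          simp only [ha', hb', hc']
          exact soloBlind_tri_close three τ (h q1) (h q2) (h q3) (1) (0) (0) (0) (by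
            (try simp only [zero_smul, one_smul, add_zero]); abel))
  · -- k = (2, 2, 2): zero sum on U ∪ {a, b, c}
    have N1 : a ∉ insert b (insert c U) := by
      simp only [Finset.mem_insert, not_or]; exact ⟨d_a_b, d_a_c, haU⟩
    have N2 : b ∉ insert c U := by
      simp only [Finset.mem_insert, not_or]; exact ⟨d_b_c, hbU⟩
    exact zsf (insert a (insert b (insert c U)))
      (hins _ ha _ (hins _ hb _ (hins _ hc _ hUS))) (Finset.insert_nonempty _ _)
      (by rw [Finset.sum_insert N1, Finset.sum_insert N2, Finset.sum_insert hcU, hU]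
          simp only [ha', hb', hc']
          exact soloBlind_tri_close three τ (h q1) (h q2) (h q3) (1) (0) (0) (0) (by
            (try simp only [zero_smul, one_smul, add_zero]); abel))

/-- The six triangle elements as a `Finset`. -/
def soloBlindHexad (a b c q1 q2 q3 : ι) : Finset ι := {a, b, c, q1, q2, q3}

/-- TRIANGLE MOVE, quotient side (i): modulo any hom `π` whose kernel lies in `K'`, the outside set
`S \ hexad` is zero-sum free. -/
theorem soloBlind_triangle_quot_zsf (three : ∀ g : G, g + g + g = 0) {h : ι → G} {S : Finset ι}
    (zsf : ∀ T ⊆ S, T.Nonempty → ∑ i ∈ T, h i ≠ 0) {τ : G} (hgood : ∀ T ⊆ S, ∑ i ∈ T, h i ≠ τ + τ)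
    {a b c q1 q2 q3 : ι} (ha : a ∈ S) (hb : b ∈ S) (hc : c ∈ S) (hq1 : q1 ∈ S) (hq2 : q2 ∈ S)
    (hq3 : q3 ∈ S) (d_a_b : a ≠ b) (d_a_c : a ≠ c) (d_a_q1 : a ≠ q1) (d_a_q2 : a ≠ q2)
    (d_a_q3 : a ≠ q3) (d_b_c : b ≠ c) (d_b_q1 : b ≠ q1) (d_b_q2 : b ≠ q2) (d_b_q3 : b ≠ q3)
    (d_c_q1 : c ≠ q1) (d_c_q2 : c ≠ q2) (d_c_q3 : c ≠ q3) (d_q1_q2 : q1 ≠ q2) (d_q1_q3 : q1 ≠ q3)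
    (d_q2_q3 : q2 ≠ q3)
    (hA : h a + h q1 + h q3 = τ) (hB : h b + h q1 + h q2 = τ) (hC : h c + h q2 + h q3 = τ)
    (π : G →+ G')
    (hker : ∀ g : G, π g = 0 → ∃ n1 n2 n3 : ℕ, n1 < 3 ∧ n2 < 3 ∧ n3 < 3 ∧
      g = n1 • h q1 + n2 • h q2 + n3 • h q3) :
    ∀ T ⊆ S \ soloBlindHexad a b c q1 q2 q3, T.Nonempty → ∑ i ∈ T, π (h i) ≠ 0 := by
  intro T hT hne hsum
  have hTS : T ⊆ S := fun i hi => (Finset.mem_sdiff.mp (hT hi)).1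
  have hout : ∀ z ∈ soloBlindHexad a b c q1 q2 q3, z ∉ T := fun z hz hzT =>
    (Finset.mem_sdiff.mp (hT hzT)).2 hz
  have hπ : π (∑ i ∈ T, h i) = 0 := by rw [map_sum]; exact hsum
  obtain ⟨n1, n2, n3, hn1, hn2, hn3, hk⟩ := hker _ hπ
  exact soloBlind_triangle_sum_ne_combo
    three zsf hgood ha hb hc hq1 hq2 hq3 d_a_b d_a_c d_a_q1 d_a_q2
    d_a_q3 d_b_c d_b_q1 d_b_q2 d_b_q3 d_c_q1 d_c_q2 d_c_q3 d_q1_q2 d_q1_q3 d_q2_q3 hA hB hC hTS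
    (hout a (by simp [soloBlindHexad])) (hout b (by simp [soloBlindHexad]))
    (hout c (by simp [soloBlindHexad])) (hout q1 (by simp [soloBlindHexad]))
    (hout q2 (by simp [soloBlindHexad])) (hout q3 (by simp [soloBlindHexad])) hne n1 n2 n3 hn1 hn2
    hn3 hk

end Summit.MatrixMultiplication.MatrixMultiplication.Theorems
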